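import Literature.Analysis.OperatorTheory.YangMillsMatrixModelCoreDatum
import Literature.Analysis.OperatorTheory.YangMillsMatrixModelCoreAbsStability
import HarnessLib

/-!
# `|·|`-stability of the NAMED core datum of Lüscher's form (`habs` by name)

Topic `Literature/Analysis/OperatorTheory`; a two-theorem join of `YangMillsMatrixModelCoreDatum.lean` (the named Kato
datum `coreSpace`, `coreEmbedding`, `coreOp`, `coreInv` of Lüscher's form on the invariant `C²_c` core) and
`YangMillsMatrixModelCoreAbsStability.lean` (`coreMap_abs_stability`, Beurling–Deny regularisation `√(ψ²+δ²) − δ` for an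
abstract feature map): the hypothesis `habs` of the simplicity criterion
`Literature.Analysis.UnboundedOperators.sInf_coreLevelSet_zero_lt_one` for THIS datum, stated with the tree's names, so
that the discharge of `LuscherSimonGap` can cite it directly.  Theorems only; NOT a claim about any gap.

## References
* [LiebLoss2001] E. H. Lieb, M. Loss, *Analysis*, 2nd ed., Thm 7.8, Thm 11.8.
-/

noncomputable section

open MeasureTheory Filter Topology Real
open scoped InnerProductSpace

namespace Literature.Analysis.OperatorTheory.YMMatrixModel

/-- ★ **`habs` for the named datum**: for every `f ∈ coreSpace` and `ε > 0` there is `f' ∈ coreSpace` with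
`‖coreEmbedding f' − |coreEmbedding f|‖_{L²} ≤ ε` and `‖f'‖ ≤ ‖f‖ + ε` (Beurling–Deny: the invariant `C²_c` core is
stable under `|·|` up to `ε` without raising the form norm). [cite: LiebLoss2001, Thm. 7.8] -/
theorem coreSpace_abs_stability (f : coreSpace) {ε : ℝ} (hε : 0 < ε) :
    ∃ f' : coreSpace, ‖coreEmbedding f' - |coreEmbedding f|‖ ≤ ε ∧ ‖f'‖ ≤ ‖f‖ + ε :=
  coreMap_abs_stability coreSubmodule_mem_spec coreFeature coreFeature_apply_none coreFeature_apply_some_none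
    coreFeature_apply_some_some (fun _ h1 h2 => ⟨h1, h2⟩) coreInv coreFeature_coreInv coreInv_coreFeature
    coreEmbedding coreEmbedding_apply f hε

/-- The same in the literal binder shape of `sInf_coreLevelSet_zero_lt_one`'s `habs`
(`∀ (f : V) (ε : ℝ), 0 < ε → ∃ f', …`). [cite: LiebLoss2001, Thm. 11.8] -/
theorem coreSpace_habs :
    ∀ (f : coreSpace) (ε : ℝ), 0 < ε →
      ∃ f' : coreSpace, ‖coreEmbedding f' - |coreEmbedding f|‖ ≤ ε ∧ ‖f'‖ ≤ ‖f‖ + ε :=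
  fun f _ hε => coreSpace_abs_stability f hε

end Literature.Analysis.OperatorTheory.YMMatrixModel

end
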